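import Mathlib
import Summits.Ventures.HodgeRepro.LemmaPi

/-!
# Isotypic decomposition of a stable subspace ("Artin independence isolates each component")

ROUTE.md §1 row S3ᴿ (Lemma R, the converse of André's reduction) and Appendix A5 (1) both use the
same piece of linear algebra: a family of commuting algebraic correspondences `a^*` (`a ∈ F^×`, or
`(F^×)^{2p}`) acts on `H^•(B, ℂ)` through finitely many DISTINCT characters, so every
`ℚ`-rational subspace stable under the correspondences — the algebraic classes, the image of a
pull-back `f^*` — is the direct sum of its intersections with the isotypic pieces
("Artin independence of the characters … isolates each eigen-component of a ℚ-rational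
pull-back; a ℚ-subspace is determined by its complexification", ROUTE.md §2 row "S3ᴿ: geometric
half").  `LemmaPi.lean` proved the two-piece case (Weil line + complement) by Bezout.  This file
proves the general finite case by the Chinese remainder theorem in `K[X]`:

* `exists_partition_of_unity`: for pairwise coprime `f i` (`i ∈ s`) with `(∏ f i)(T) = 0` there
  are polynomials `e i` with `(e i)(T) x ∈ ker (f i)(T)` and `∑ (e i)(T) x = x` — the isotypic
  projectors are polynomials in the ONE operator `T`, over the ground field `K` (here `ℚ`): no
  extension of scalars and no Galois descent is needed.
* `exists_sum_eq_of_mem` / `eq_iSup_inf_ker`: a `T`-stable subspace `U` equals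
  `⨆ i, U ⊓ ker (f i)(T)` — each isotypic component of an element of `U` lies in `U`.

Over `ℂ` the `f i` are the linear factors `X − χ_i(a)` of one separating `a`; over `ℚ` they are
the Galois-orbit blocks (products of conjugate linear factors), which is exactly the form in which
the route uses the statement.  The operator `T` is the single correspondence `a^*`; the existence
of a separating `a` (Zariski density of `F^×` in the torus) is the route's printed/structural
input and is a hypothesis here (pairwise coprimality).
-/

namespace HodgeRepro.LemmaPi

open Polynomial Finset Function

section Isotypic

variable {K : Type*} [Field K] {V : Type*} [AddCommGroup V] [Module K V]
variable {ι : Type*} [DecidableEq ι]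

/-- **Partition of unity by polynomials in `T`.** For pairwise coprime `f i`, `i ∈ s`, with
`(∏ f i)(T) = 0`, there are `e i ∈ K[X]` with `(e i)(T) x ∈ ker (f i)(T)` for every `x` and
`∑ i ∈ s, (e i)(T) x = x`. -/
theorem exists_partition_of_unity (T : Module.End K V) (s : Finset ι) (f : ι → K[X])
    (hf : (s : Set ι).Pairwise (IsCoprime on f)) (h : aeval T (∏ i ∈ s, f i) = 0) :
    ∃ e : ι → K[X], (∀ i ∈ s, ∀ x : V, aeval T (e i) x ∈ LinearMap.ker (aeval T (f i))) ∧
      ∀ x : V, ∑ i ∈ s, aeval T (e i) x = x := by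
  classical
  -- for each `i`, `f i` is coprime to `g i := ∏_{j ≠ i} f j`
  have hcop : ∀ i ∈ s, IsCoprime (f i) (∏ j ∈ s.erase i, f j) := by
    intro i hi
    refine IsCoprime.prod_right fun j hj => ?_
    exact hf hi (mem_of_mem_erase hj) (ne_of_mem_erase hj).symm
  -- Bezout partners, chosen classically
  choose! u v huv using fun i (hi : i ∈ s) => hcop i hi
  refine ⟨fun i => v i * ∏ j ∈ s.erase i, f j, ?_, ?_⟩
  · intro i hi x
    have hprod : f i * (v i * ∏ j ∈ s.erase i, f j) = v i * ∏ j ∈ s, f j := by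
      rw [← mul_prod_erase s f hi]; ring
    rw [LinearMap.mem_ker, ← Module.End.mul_apply, ← map_mul, hprod, map_mul, h, mul_zero,
      LinearMap.zero_apply]
  · intro x
    -- `∏ f ∣ ∑ e − 1` since every `f j` divides it
    have hdvd : (∏ i ∈ s, f i) ∣ (∑ i ∈ s, v i * ∏ j ∈ s.erase i, f j) - 1 := by
      refine prod_dvd_of_coprime hf fun j hj => ?_
      rw [← add_sum_erase s _ hj]
      have h1 : f j ∣ (v j * ∏ k ∈ s.erase j, f k) - 1 := by
        have := huv j hj
        -- `u j * f j + v j * g j = 1`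
        exact ⟨-u j, by linear_combination this⟩
      have h2 : f j ∣ ∑ i ∈ s.erase j, v i * ∏ k ∈ s.erase i, f k := by
        refine dvd_sum fun i hi => ?_
        refine Dvd.dvd.mul_left ?_ _
        exact dvd_prod_of_mem f (mem_erase.mpr ⟨(ne_of_mem_erase hi).symm, hj⟩)
      have : (v j * ∏ k ∈ s.erase j, f k) + ∑ i ∈ s.erase j, v i * ∏ k ∈ s.erase i, f k - 1 =
          ((v j * ∏ k ∈ s.erase j, f k) - 1) + ∑ i ∈ s.erase j, v i * ∏ k ∈ s.erase i, f k := by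
        ring
      rw [this]
      exact dvd_add h1 h2
    obtain ⟨w, hw⟩ := hdvd
    have hsum : aeval T (∑ i ∈ s, v i * ∏ j ∈ s.erase i, f j) = 1 := by
      have : (∑ i ∈ s, v i * ∏ j ∈ s.erase i, f j) = 1 + (∏ i ∈ s, f i) * w := by
        rw [← hw]; ring
      rw [this, map_add, map_one, map_mul, h, zero_mul, add_zero]
    have := congrArg (fun φ : Module.End K V => φ x) hsum
    simpa only [map_sum, LinearMap.sum_apply, Module.End.one_apply] using this

/-- **Isotypic components of a stable subspace.** If `U` is `T`-stable, every `u ∈ U` is the sum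
of components `c i ∈ U ⊓ ker (f i)(T)`, `i ∈ s`. -/
theorem exists_sum_eq_of_mem (T : Module.End K V) (U : Submodule K V) (hU : ∀ x ∈ U, T x ∈ U)
    (s : Finset ι) (f : ι → K[X]) (hf : (s : Set ι).Pairwise (IsCoprime on f))
    (h : aeval T (∏ i ∈ s, f i) = 0) {u : V} (hu : u ∈ U) :
    ∃ c : ι → V, (∀ i ∈ s, c i ∈ U ⊓ LinearMap.ker (aeval T (f i))) ∧ ∑ i ∈ s, c i = u := by
  obtain ⟨e, he1, he2⟩ := exists_partition_of_unity T s f hf h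
  exact ⟨fun i => aeval T (e i) u, fun i hi => ⟨aeval_apply_mem T U hU _ hu, he1 i hi u⟩, he2 u⟩

/-- A `T`-stable subspace is the supremum of its isotypic pieces: `U = ⨆ i ∈ s, U ⊓ ker (f i)(T)`. -/
theorem eq_iSup_inf_ker (T : Module.End K V) (U : Submodule K V) (hU : ∀ x ∈ U, T x ∈ U)
    (s : Finset ι) (f : ι → K[X]) (hf : (s : Set ι).Pairwise (IsCoprime on f))
    (h : aeval T (∏ i ∈ s, f i) = 0) :
    U = ⨆ i ∈ s, (U ⊓ LinearMap.ker (aeval T (f i))) := by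
  apply le_antisymm
  · intro u hu
    obtain ⟨c, hc, rfl⟩ := exists_sum_eq_of_mem T U hU s f hf h hu
    exact Submodule.sum_mem _ fun i hi =>
      Submodule.mem_iSup_of_mem i (Submodule.mem_iSup_of_mem hi (hc i hi))
  · exact iSup₂_le fun i _ => inf_le_left

end Isotypic

end HodgeRepro.LemmaPi
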